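import Summits.AnomalousDissipation.AnomalousDissipation.Theorems.SawtoothPulseCascadeK1LocalisedCascadePhaseOneHFibreEval

/-!
# K1loc explicit start, phase 1: the fibre `ℓ¹` sums `L̄(n) = Σ_{1≤|q|≤Q_c} ‖𝓕a₁(n,q)‖` — evaluation lemma («PhaseOneL1Eval»)

Helper file of the prover lane on the crux `K1LocalisedCascade` (stmt-AnomalousDissipation-19491), route `SawtoothPulseCascade`
(arbiter A24-5 R1, off-tube energy of `b₁` / profile-Minkowski tables).  For the generated `ℓ¹` tables of the phase-1 H-fibres:
* `sum_srcSet_eq_sum_range`: `Σ_{1≤|q|≤Q} f(q) = Σ_{i<Q} (f(i+1) + f(−(i+1)))`;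
* **`phaseOne_L1_le_eval`**: under the cascade hypotheses, if `Σ_{i<Q_c} 2·Ā(n, i+1) ≤ v` (the rational amplitude table
  `phaseOne_amplitude_le_rat`, even in `q` by `abar_neg`) then `Σ_{q : 1≤|q|≤Q_c} ‖𝓕a₁(n,q)‖ ≤ v`.
No definitions; nothing about the crux. [cite: Grafakos2014, Prop. 3.2.7 (3)] [problem: turb]
-/

-- `Summit.<Summit>.<Problem>`: single-conjunct summit, the duplicate namespace segment is deliberate.
set_option linter.dupNamespace false

noncomputable section

namespace Summit.AnomalousDissipation.AnomalousDissipation.Theorems.SawtoothPulseCascade.K1Start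

open MeasureTheory Filter Topology UnitAddTorus Complex AddCircle
open scoped Real
open Literature.Analysis Literature.Analysis.FunctionSpaces Literature.Analysis.FunctionSpaces.Torus Literature.Analysis.FluidPDE
open Literature.Analysis.FluidPDE.ShearStage
open Literature.Analysis.FluidPDE.SawtoothCascade Literature.Analysis.FluidPDE.SawtoothCascade.CascadeParams
open Summit.AnomalousDissipation.AnomalousDissipation.Theorems.SawtoothPulseCascade.K1Window

/-! ## §1 The symmetric source set -/

/-- `Σ_{q ∈ [−Q,Q], 1 ≤ |q|} f(q) = Σ_{i<Q} (f(i+1) + f(−(i+1)))`. [folklore] -/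
theorem sum_srcSet_eq_sum_range (f : ℤ → ℝ) (Q : ℕ) :
    ∑ q ∈ (Finset.Icc (-(Q : ℤ)) Q).filter (fun q => 1 ≤ |q|), f q =
      ∑ i ∈ Finset.range Q, (f ((i : ℤ) + 1) + f (-((i : ℤ) + 1))) := by
  classical
  have hsplit : (Finset.Icc (-(Q : ℤ)) Q).filter (fun q => 1 ≤ |q|) =
      Finset.Icc (1 : ℤ) Q ∪ (Finset.Icc (1 : ℤ) Q).image (fun q => -q) := by
    ext q
    rw [Finset.mem_filter, Finset.mem_Icc, Finset.mem_union, Finset.mem_Icc, Finset.mem_image]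
    constructor
    · rintro ⟨⟨h1, h2⟩, h3⟩
      rcases le_abs'.1 h3 with h | h
      · right; exact ⟨-q, Finset.mem_Icc.2 ⟨by omega, by omega⟩, by omega⟩
      · left; exact ⟨h, h2⟩
    · rintro (⟨h1, h2⟩ | ⟨m, hm, rfl⟩)
      · exact ⟨⟨by omega, h2⟩, by rw [le_abs]; omega⟩
      · rw [Finset.mem_Icc] at hm
        exact ⟨⟨by omega, by omega⟩, by rw [le_abs]; omega⟩
  have hdisj : Disjoint (Finset.Icc (1 : ℤ) Q) ((Finset.Icc (1 : ℤ) Q).image (fun q => -q)) := by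
    rw [Finset.disjoint_left]; intro q h1 h2
    rw [Finset.mem_Icc] at h1; rw [Finset.mem_image] at h2
    obtain ⟨m, hm, rfl⟩ := h2; rw [Finset.mem_Icc] at hm; omega
  rw [hsplit, Finset.sum_union hdisj, Finset.sum_image fun a _ b _ h => by simpa using h,
    sum_Icc_one_eq_sum_range, Finset.sum_add_distrib]
  congr 1
  rw [sum_Icc_one_eq_sum_range]

section Cascade

variable (P : CascadeParams)

/-! ## §2 The `ℓ¹` evaluation lemma -/

/-- **`ℓ¹` evaluation of a phase-1 H-fibre**: if the doubled amplitude table sums to at most `v`,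
`Σ_{i<Q_c} 2·Ā(n,i+1) ≤ v`, then `Σ_{1≤|q|≤Q_c} ‖𝓕a₁(n,q)‖ ≤ v`. [cite: Grafakos2014, Prop. 3.2.7 (3)] -/
theorem phaseOne_L1_le_eval (hγ : P.γ = 8) (hN₀ : P.N₀ = 1) (hδ₀ : 0 < P.δ₀) (hδ₀' : P.δ₀ ≤ (2 : ℝ)⁻¹ ^ 30) (hd : 0 < P.d)
    (a b : ℕ → UnitAddTorus (Fin 2) → ℝ) (h0 : a 0 = datum)
    (hb : b 0 = a 0 ∘ shearMap 0 1 (amp ⟨P.U 0, P.U_periodic 0, P.contDiff_U (P.δ_pos hδ₀ hd 0)⟩ P.γ))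
    (hab : a 1 = b 0 ∘ shearMap 1 0 (amp ⟨P.U 0, P.U_periodic 0, P.contDiff_U (P.δ_pos hδ₀ hd 0)⟩ P.γ))
    (n : ℤ) (Qc : ℕ) {v : ℝ}
    (hv : ∑ i ∈ Finset.range Qc, 2 * (1 / 2 * ((if ((i : ℤ) + 1) = 8 ∨ ((i : ℤ) + 1) = -8 then (1 / 2 : ℝ)
          else if ((i : ℤ) + 1) % 2 = 0 then 0 else 16 * 0.31831 / |64 - ((((i : ℤ) + 1 : ℤ)) : ℝ) ^ 2|) + (2 : ℝ)⁻¹ ^ 25) *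
        ((if 8 * ((i : ℤ) + 1) + (n + 1) = 0 ∨ 8 * ((i : ℤ) + 1) - (n + 1) = 0 then (1 / 2 : ℝ) else if (n + 1) % 2 = 0 then 0
            else 16 * |((((i : ℤ) + 1 : ℤ)) : ℝ)| * 0.31831 / |64 * ((((i : ℤ) + 1 : ℤ)) : ℝ) ^ 2 - ((n + 1 : ℤ) : ℝ) ^ 2|) +
          (if 8 * ((i : ℤ) + 1) + (n - 1) = 0 ∨ 8 * ((i : ℤ) + 1) - (n - 1) = 0 then (1 / 2 : ℝ) else if (n - 1) % 2 = 0 then 0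
            else 16 * |((((i : ℤ) + 1 : ℤ)) : ℝ)| * 0.31831 / |64 * ((((i : ℤ) + 1 : ℤ)) : ℝ) ^ 2 - ((n - 1 : ℤ) : ℝ) ^ 2|) +
          2 * |((((i : ℤ) + 1 : ℤ)) : ℝ)| * (2 : ℝ)⁻¹ ^ 25)) ≤ v) :
    ∑ q ∈ (Finset.Icc (-(Qc : ℤ)) Qc).filter (fun q => 1 ≤ |q|), ‖mFourierCoeff (fun x => (a 1 x : ℂ)) ![n, q]‖ ≤ v := by
  rw [sum_srcSet_eq_sum_range]
  refine le_trans (Finset.sum_le_sum fun i _ => ?_) hv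
  have hq1 : ((i : ℤ) + 1) ≠ 0 := by omega
  have hq2 : (-((i : ℤ) + 1)) ≠ 0 := by omega
  have h1 := phaseOne_amplitude_le_rat P hγ hN₀ hδ₀ hδ₀' hd a b h0 hb hab n hq1
  have h2 := phaseOne_amplitude_le_rat P hγ hN₀ hδ₀ hδ₀' hd a b h0 hb hab n hq2
  rw [abar_neg n ((i : ℤ) + 1)] at h2
  have e : ((((i : ℤ) + 1 : ℤ)) : ℝ) = ((i : ℤ) : ℝ) + 1 := by push_cast; ring
  linarith

end Cascade

end Summit.AnomalousDissipation.AnomalousDissipation.Theorems.SawtoothPulseCascade.K1Start
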